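import Summits.Ventures.DiscreteObjects.PP12.OrderElevenTrianglePartition

/-!
# PP(12), order-11 cell, Case B (triangle): the plane's `TriangleData 11` is valid (kernel; proofs)
Framing: lottery ticket; floor = certified bounds/negative ranges.

Cell pub-namedobj (venture DiscreteObjects), target (M), designs gen 16. Setting and notation of `OrderElevenTriangleFrame`; `D = triData11`.
* `two_line11`: two distinct lines whose common point is free share exactly one decomposed point `σ^x P_t`;
* **(D) `internalOK11`**: `B_s ∩ σ^δ B_s` (`δ ≠ 0`) is a free point, so the internal differences of row `s` hit `δ` exactly once;
* **(X) `crossOK11`** (`s ≠ s'`): `g1 s ≠ g1 s'`, `g2 s ≠ g2 s'`, no common free point of `B_s, B_{s'}`, and for `δ ≠ 0` the common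
  point `R` of `B_s` and `σ^δ B_{s'}` lies on `S_1` iff `g1 s − g1 s' = δ`, on `S_2` iff `g2 s − g2 s' = δ`, never on `S_0`, and is free
  iff the pair condition `PairOne` holds — whence the trichotomy of `TriangleData.CrossOK`;
* **`triData11_valid : (σ.triData11 h12 hq hB).Valid`**.
Proofs only; nothing asserts any census statement. No `sorry`, no new axioms.
-/

namespace Summit.Ventures.DiscreteObjects.PP12

open Configuration Finset
open scoped Classical

namespace Collineation

variable {P L : Type*} [Membership P L] (σ : Collineation P L) [ProjectivePlane P L] [Fintype P] [Fintype L]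

section ElevenB

variable (h12 : ProjectivePlane.order P L = 12) (hq : σ.onPoints ^ 11 = 1)
  (hB : ∀ l : L, σ.onLines l = l → ∀ [DecidablePred (· ∈ l)], σ.fixedOnLine l = 2)

/-- **Two-line lemma.** Two distinct lines whose common points are free share exactly one decomposed point. -/
theorem two_line11 {ℓ ℓ' : L} (hne : ℓ ≠ ℓ') (hfree : ∀ R : P, R ∈ ℓ → R ∈ ℓ' → R ∈ σ.freePts h12 hq hB) :
    ∃ t x : Fin 11, ((σ.onPoints ^ (x : ℕ)) (σ.fp11 h12 hq hB t) ∈ ℓ ∧ (σ.onPoints ^ (x : ℕ)) (σ.fp11 h12 hq hB t) ∈ ℓ') ∧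
      ∀ t' x' : Fin 11, (σ.onPoints ^ (x' : ℕ)) (σ.fp11 h12 hq hB t') ∈ ℓ → (σ.onPoints ^ (x' : ℕ)) (σ.fp11 h12 hq hB t') ∈ ℓ' →
        t' = t ∧ x' = x := by
  set R : P := HasPoints.mkPoint hne with hRdef
  have hR1 : R ∈ ℓ := (HasPoints.mkPoint_ax hne).1
  have hR2 : R ∈ ℓ' := (HasPoints.mkPoint_ax hne).2
  obtain ⟨t, x, htx⟩ := σ.free_decomp h12 hq hB (hfree R hR1 hR2)
  refine ⟨t, x, ⟨htx ▸ hR1, htx ▸ hR2⟩, fun t' x' h1 h2 => ?_⟩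
  have e : (σ.onPoints ^ (x' : ℕ)) (σ.fp11 h12 hq hB t') = R := (Nondegenerate.eq_or_eq h1 hR1 h2 hR2).resolve_right hne
  exact σ.free_decomp_unique h12 hq hB (e.trans htx.symm)

/-- a point of a free base line fixed by `σ^δ` does not exist unless `11 ∣ δ` … in the form: a common point of `B_s` and `σ^δ B_s` is free -/
theorem free_of_mem_fb11_pow_fb11 (s : Fin 11) {δ : ℕ} (hδ : ¬ 11 ∣ δ) {R : P} (h1 : R ∈ σ.fb11 h12 hq hB s)
    (h2 : R ∈ (σ.onLines ^ δ) (σ.fb11 h12 hq hB s)) : R ∈ σ.freePts h12 hq hB := by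
  have F := σ.fb11_mem_freeLns h12 hq hB s
  rw [mem_freeLns] at F
  have SF := σ.sd_fixed h12 hq hB
  have NS := σ.fb11_ne_sd h12 hq hB s
  -- if R were on a side S, then R and σ^{-δ} R would both be the point B_s ∩ S
  have key : ∀ {S : L}, σ.onLines S = S → σ.fb11 h12 hq hB s ≠ S → R ∉ S := by
    intro S fS hS hRS
    rw [σ.mem_pow_apply_iff] at h2
    have h3 : (σ.onPoints ^ δ).symm R ∈ S := σ.pow_symm_apply_mem_of_fixed fS hRS δ
    have e : R = (σ.onPoints ^ δ).symm R := (Nondegenerate.eq_or_eq h1 h2 hRS h3).resolve_right hS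
    have fix : (σ.onPoints ^ δ) R = R := by conv_lhs => rw [e]; exact (σ.onPoints ^ δ).apply_symm_apply R
    rcases (σ.tv_spec h12 hq hB).2.2.2.2.2.2.2 R (σ.fixed_of_pow_fixed hq hδ fix) with rfl | rfl | rfl
    · exact F.1 h1
    · exact F.2.1 h1
    · exact F.2.2 h1
  rw [mem_freePts]
  exact ⟨key SF.1 NS.1, key SF.2.1 NS.2.1, key SF.2.2 NS.2.2⟩

/-- a non-zero residue is not a multiple of 11 -/
theorem not_dvd_of_fin11_ne_zero {δ : Fin 11} (hδ : δ ≠ 0) : ¬ 11 ∣ (δ : ℕ) := fun h =>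
  hδ (Fin.ext (by have := δ.isLt; simp only [Fin.val_zero]; omega))

/-- **(D) internal differences** -/
theorem internalOK11 (s : Fin 11) : (σ.triData11 h12 hq hB).InternalOK s := by
  intro δ hδ
  have hδ' := not_dvd_of_fin11_ne_zero hδ
  have hne : σ.fb11 h12 hq hB s ≠ (σ.onLines ^ (δ : ℕ)) (σ.fb11 h12 hq hB s) := (σ.pow_fb11_ne h12 hq hB hδ' s).symm
  obtain ⟨t, x, ⟨h1, h2⟩, huniq⟩ := σ.two_line11 h12 hq hB hne (fun R hR1 hR2 => σ.free_of_mem_fb11_pow_fb11 h12 hq hB s hδ' hR1 hR2)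
  refine ⟨t, x, (σ.triData11_mem h12 hq hB s t x).2 h1, ?_, fun t' x' h1' h2' => huniq t' x' ((σ.triData11_mem h12 hq hB s t' x').1 h1') ?_⟩
  · rw [triData11_mem, σ.pow_fin_sub_apply_mem_iff hq]; exact h2
  · rw [triData11_mem, σ.pow_fin_sub_apply_mem_iff hq] at h2'; exact h2'

/-! ### (X) -/

/-- `B_s ≠ σ^δ B_{s'}` for `δ ≠ 0` -/
theorem fb11_ne_pow_fb11 (s s' : Fin 11) {δ : Fin 11} (hδ : δ ≠ 0) :
    σ.fb11 h12 hq hB s ≠ (σ.onLines ^ (δ : ℕ)) (σ.fb11 h12 hq hB s') := fun e =>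
  not_dvd_of_fin11_ne_zero hδ (σ.dvd_of_sq0_mem_pow_fb11 h12 hq hB (e ▸ (σ.fb11_spec h12 hq hB s).1))

/-- the common point of `B_s` and `σ^δ B_{s'}` (`δ ≠ 0`) is off `S_0` -/
theorem meet_not_mem_sd0 (s s' : Fin 11) {δ : Fin 11} (hδ : δ ≠ 0) {R : P} (h1 : R ∈ σ.fb11 h12 hq hB s)
    (h2 : R ∈ (σ.onLines ^ (δ : ℕ)) (σ.fb11 h12 hq hB s')) : R ∉ σ.sd0 h12 hq hB := fun h => by
  have e := σ.eq_sq0_of_mem_fb11_sd0 h12 hq hB s h1 h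
  rw [e] at h2
  exact not_dvd_of_fin11_ne_zero hδ (σ.dvd_of_sq0_mem_pow_fb11 h12 hq hB h2)

/-- **position criterion on `S_1`**: the common point `R` of `B_s` and `σ^δ B_{s'}` lies on `S_1` iff `g1 s − g1 s' = δ` -/
theorem mem_sd1_iff (s s' : Fin 11) {δ : Fin 11} (hδ : δ ≠ 0) {R : P} (h1 : R ∈ σ.fb11 h12 hq hB s)
    (h2 : R ∈ (σ.onLines ^ (δ : ℕ)) (σ.fb11 h12 hq hB s')) :
    R ∈ σ.sd1 h12 hq hB ↔ (σ.triData11 h12 hq hB).g1 s - (σ.triData11 h12 hq hB).g1 s' = δ := by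
  set a := (σ.triData11 h12 hq hB).g1 s with ha
  set a' := (σ.triData11 h12 hq hB).g1 s' with ha'
  have hA : (σ.onPoints ^ (a : ℕ)) (σ.sq1 h12 hq hB) ∈ σ.fb11 h12 hq hB s := σ.pow_g1_sq1_mem h12 hq hB s
  have hA' : (σ.onPoints ^ (a' : ℕ)) (σ.sq1 h12 hq hB) ∈ σ.fb11 h12 hq hB s' := σ.pow_g1_sq1_mem h12 hq hB s'
  have hne := σ.fb11_ne_pow_fb11 h12 hq hB s s' hδ
  have SM := fun k => (σ.pow_sq_mem h12 hq hB k).2.1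
  constructor
  · intro hR
    -- R = σ^a Q_1 and σ^{-δ} R = σ^{a'} Q_1
    have e1 : R = (σ.onPoints ^ (a : ℕ)) (σ.sq1 h12 hq hB) :=
      (Nondegenerate.eq_or_eq h1 hA hR (SM _)).resolve_right (σ.fb11_ne_sd h12 hq hB s).2.1
    have h2' := h2
    rw [σ.mem_pow_apply_iff] at h2'
    have h3 : (σ.onPoints ^ (δ : ℕ)).symm R ∈ σ.sd1 h12 hq hB := σ.pow_symm_apply_mem_of_fixed (σ.sd_fixed h12 hq hB).2.1 hR _
    have e2 : (σ.onPoints ^ (δ : ℕ)).symm R = (σ.onPoints ^ (a' : ℕ)) (σ.sq1 h12 hq hB) :=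
      (Nondegenerate.eq_or_eq h2' hA' h3 (SM _)).resolve_right (σ.fb11_ne_sd h12 hq hB s').2.1
    have e3 : (σ.onPoints ^ (a : ℕ)) (σ.sq1 h12 hq hB) = (σ.onPoints ^ ((δ + a' : Fin 11) : ℕ)) (σ.sq1 h12 hq hB) := by
      rw [σ.pow_fin_add_apply hq, ← e2, Equiv.apply_symm_apply, e1]
    have m := pow_apply_mod_inj σ.onPoints hq (fun k hk => (σ.pow_sq_ne h12 hq hB hk).2.1) e3
    rw [Nat.mod_eq_of_lt a.isLt, Nat.mod_eq_of_lt (δ + a').isLt] at m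
    rw [sub_eq_iff_eq_add]; exact Fin.ext m
  · intro hsub
    have e : a = δ + a' := sub_eq_iff_eq_add.1 hsub
    have hAA : (σ.onPoints ^ (a : ℕ)) (σ.sq1 h12 hq hB) ∈ (σ.onLines ^ (δ : ℕ)) (σ.fb11 h12 hq hB s') := by
      rw [e, σ.pow_fin_add_apply hq]; exact (σ.pow_mem_iff _ _ _).2 hA'
    have eR : (σ.onPoints ^ (a : ℕ)) (σ.sq1 h12 hq hB) = R := (Nondegenerate.eq_or_eq hA h1 hAA h2).resolve_right hne
    rw [← eR]; exact SM _

/-- **position criterion on `S_2`**: `R ∈ S_2 ↔ g2 s − g2 s' = δ` -/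
theorem mem_sd2_iff (s s' : Fin 11) {δ : Fin 11} (hδ : δ ≠ 0) {R : P} (h1 : R ∈ σ.fb11 h12 hq hB s)
    (h2 : R ∈ (σ.onLines ^ (δ : ℕ)) (σ.fb11 h12 hq hB s')) :
    R ∈ σ.sd2 h12 hq hB ↔ (σ.triData11 h12 hq hB).g2 s - (σ.triData11 h12 hq hB).g2 s' = δ := by
  set a := (σ.triData11 h12 hq hB).g2 s with ha
  set a' := (σ.triData11 h12 hq hB).g2 s' with ha'
  have hA : (σ.onPoints ^ (a : ℕ)) (σ.sq2 h12 hq hB) ∈ σ.fb11 h12 hq hB s := σ.pow_g2_sq2_mem h12 hq hB s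
  have hA' : (σ.onPoints ^ (a' : ℕ)) (σ.sq2 h12 hq hB) ∈ σ.fb11 h12 hq hB s' := σ.pow_g2_sq2_mem h12 hq hB s'
  have hne := σ.fb11_ne_pow_fb11 h12 hq hB s s' hδ
  have SM := fun k => (σ.pow_sq_mem h12 hq hB k).2.2
  constructor
  · intro hR
    have e1 : R = (σ.onPoints ^ (a : ℕ)) (σ.sq2 h12 hq hB) :=
      (Nondegenerate.eq_or_eq h1 hA hR (SM _)).resolve_right (σ.fb11_ne_sd h12 hq hB s).2.2
    have h2' := h2
    rw [σ.mem_pow_apply_iff] at h2'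
    have h3 : (σ.onPoints ^ (δ : ℕ)).symm R ∈ σ.sd2 h12 hq hB := σ.pow_symm_apply_mem_of_fixed (σ.sd_fixed h12 hq hB).2.2 hR _
    have e2 : (σ.onPoints ^ (δ : ℕ)).symm R = (σ.onPoints ^ (a' : ℕ)) (σ.sq2 h12 hq hB) :=
      (Nondegenerate.eq_or_eq h2' hA' h3 (SM _)).resolve_right (σ.fb11_ne_sd h12 hq hB s').2.2
    have e3 : (σ.onPoints ^ (a : ℕ)) (σ.sq2 h12 hq hB) = (σ.onPoints ^ ((δ + a' : Fin 11) : ℕ)) (σ.sq2 h12 hq hB) := by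
      rw [σ.pow_fin_add_apply hq, ← e2, Equiv.apply_symm_apply, e1]
    have m := pow_apply_mod_inj σ.onPoints hq (fun k hk => (σ.pow_sq_ne h12 hq hB hk).2.2) e3
    rw [Nat.mod_eq_of_lt a.isLt, Nat.mod_eq_of_lt (δ + a').isLt] at m
    rw [sub_eq_iff_eq_add]; exact Fin.ext m
  · intro hsub
    have e : a = δ + a' := sub_eq_iff_eq_add.1 hsub
    have hAA : (σ.onPoints ^ (a : ℕ)) (σ.sq2 h12 hq hB) ∈ (σ.onLines ^ (δ : ℕ)) (σ.fb11 h12 hq hB s') := by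
      rw [e, σ.pow_fin_add_apply hq]; exact (σ.pow_mem_iff _ _ _).2 hA'
    have eR : (σ.onPoints ^ (a : ℕ)) (σ.sq2 h12 hq hB) = R := (Nondegenerate.eq_or_eq hA h1 hAA h2).resolve_right hne
    rw [← eR]; exact SM _

/-- **(X) cross differences** -/
theorem crossOK11 {s s' : Fin 11} (hss' : s ≠ s') : (σ.triData11 h12 hq hB).CrossOK s s' := by
  have Q0 := σ.sq0_spec h12 hq hB
  refine ⟨fun e => ?_, fun e => ?_, fun t x h => ?_, fun δ hδ => ?_⟩
  · -- g1 s ≠ g1 s'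
    have h1 := σ.pow_g1_sq1_mem h12 hq hB s
    have h2 := σ.pow_g1_sq1_mem h12 hq hB s'
    rw [← e] at h2
    have eq := σ.eq_sq0_of_mem_fb11_fb11 h12 hq hB hss' h1 h2
    exact Q0.2.2 (σ.eq_tv2_of_mem_sd0_sd1 h12 hq hB Q0.1 (eq ▸ (σ.pow_sq_mem h12 hq hB _).2.1))
  · -- g2 s ≠ g2 s'
    have h1 := σ.pow_g2_sq2_mem h12 hq hB s
    have h2 := σ.pow_g2_sq2_mem h12 hq hB s'
    rw [← e] at h2
    have eq := σ.eq_sq0_of_mem_fb11_fb11 h12 hq hB hss' h1 h2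
    exact Q0.2.1 (σ.eq_tv1_of_mem_sd0_sd2 h12 hq hB Q0.1 (eq ▸ (σ.pow_sq_mem h12 hq hB _).2.2))
  · -- no common free point of B_s, B_s'
    rw [triData11_mem, triData11_mem, sub_zero] at h
    have eq := σ.eq_sq0_of_mem_fb11_fb11 h12 hq hB hss' h.1 h.2
    exact (σ.pow_sq_not_free h12 hq hB 0).1 (by rw [pow_zero, Equiv.Perm.one_apply, ← eq]; exact σ.pow_fp11_free h12 hq hB _ t)
  · -- the trichotomy for δ ≠ 0
    have hne := σ.fb11_ne_pow_fb11 h12 hq hB s s' hδ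
    set R : P := HasPoints.mkPoint hne with hRdef
    have hR1 : R ∈ σ.fb11 h12 hq hB s := (HasPoints.mkPoint_ax hne).1
    have hR2 : R ∈ (σ.onLines ^ (δ : ℕ)) (σ.fb11 h12 hq hB s') := (HasPoints.mkPoint_ax hne).2
    have C1 := σ.mem_sd1_iff h12 hq hB s s' hδ hR1 hR2
    have C2 := σ.mem_sd2_iff h12 hq hB s s' hδ hR1 hR2
    have C0 := σ.meet_not_mem_sd0 h12 hq hB s s' hδ hR1 hR2
    have F := σ.fb11_mem_freeLns h12 hq hB s
    rw [mem_freeLns] at F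
    -- R is not on two sides
    have h12' : ¬ (R ∈ σ.sd1 h12 hq hB ∧ R ∈ σ.sd2 h12 hq hB) := fun h => F.1 (σ.eq_tv0_of_mem_sd1_sd2 h12 hq hB h.1 h.2 ▸ hR1)
    -- decomposed common points are R
    have memR : ∀ t x : Fin 11, (σ.triData11 h12 hq hB).mem s t x = true ∧ (σ.triData11 h12 hq hB).mem s' t (x - δ) = true ↔
        (σ.onPoints ^ (x : ℕ)) (σ.fp11 h12 hq hB t) = R := by
      intro t x
      rw [triData11_mem, triData11_mem, σ.pow_fin_sub_apply_mem_iff hq]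
      constructor
      · rintro ⟨h1, h2⟩; exact (Nondegenerate.eq_or_eq h1 hR1 h2 hR2).resolve_right hne
      · intro e; rw [e]; exact ⟨hR1, hR2⟩
    have pairNone : R ∉ σ.freePts h12 hq hB → (σ.triData11 h12 hq hB).PairNone s s' δ := fun hRF t x h =>
      hRF ((memR t x).1 h ▸ σ.pow_fp11_free h12 hq hB _ t)
    have pairOne : R ∈ σ.freePts h12 hq hB → (σ.triData11 h12 hq hB).PairOne s s' δ := fun hRF => by
      obtain ⟨t, x, htx⟩ := σ.free_decomp h12 hq hB hRF
      refine ⟨t, x, ((memR t x).2 htx).1, ((memR t x).2 htx).2, fun t' x' h1 h2 => ?_⟩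
      exact σ.free_decomp_unique h12 hq hB (((memR t' x').1 ⟨h1, h2⟩).trans htx.symm)
    by_cases hS1 : R ∈ σ.sd1 h12 hq hB
    · refine Or.inl ⟨C1.1 hS1, fun h => h12' ⟨hS1, C2.2 h⟩, pairNone (σ.not_free_of_mem_sd h12 hq hB (Or.inr (Or.inl hS1)))⟩
    by_cases hS2 : R ∈ σ.sd2 h12 hq hB
    · refine Or.inr (Or.inl ⟨fun h => hS1 (C1.2 h), C2.1 hS2, pairNone (σ.not_free_of_mem_sd h12 hq hB (Or.inr (Or.inr hS2)))⟩)
    · refine Or.inr (Or.inr ⟨fun h => hS1 (C1.2 h), fun h => hS2 (C2.2 h), pairOne ?_⟩)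
      rw [mem_freePts]; exact ⟨C0, hS1, hS2⟩

/-- **The plane's Case-B data are a valid normal form.** -/
theorem triData11_valid : (σ.triData11 h12 hq hB).Valid :=
  ⟨σ.phiOK11 h12 hq hB, fun s => ⟨σ.partitionOK0 h12 hq hB s, σ.partitionOK1 h12 hq hB s, σ.partitionOK2 h12 hq hB s,
    σ.internalOK11 h12 hq hB s⟩, fun _ _ hss' => σ.crossOK11 h12 hq hB hss'⟩

end ElevenB

end Collineation

end Summit.Ventures.DiscreteObjects.PP12
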